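import Summits.Ventures.PercRepro.RankLevelSetExplicitCells

/-!
# PercRepro — THE BOUNDED-CORANK CORE FROM ITS POLYNOMIAL INEQUALITY, and the SHARP cell map (p9, sub-claim S4 of
the crux `C025`; `proofs/SUBCLAIM-S4-p9.md` §S4.3″)

`c025_core_of_poly` isolates the reusable kernel of `c025_core_explicit_bounded` / `c025_core_explicit_cell`: at level
`q ≥ 3`, corank `q + 1 ≤ d ≤ q + 2^q`, tail room `p + d ≥ 3(q + 2^q) + 5` and `2q ≤ p`, the `e`-free core satisfies
C-025 as soon as the `(P_d)` inequality `8·(C(p+d,q) + N) ≤ 7·2^{d−q}·C(p+q,q)` holds for every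
`N ≤ σ(d)·(q−1)·2^{d+q}·C(p+d, q−2)` with the EXACT fibre `σ(d) = Σ_{j ≤ d−q−1} C(2^q − q − 2, j)` — so every sharper
threshold is a Mathlib-only arithmetic lemma plus three lines of glue. First use: the sharp per-corank threshold
`TcellS q m = q²·2^{⌊(qm+2q+4)/2⌋+1} + 16q·2^q + 3·2^q + 2q + 5` (`c025_core_explicit_cell_sharp`; the exact constant
of the `N`-term instead of `N_term_bound`'s: at level `7`, corank `8` closes from `p = 64,915` instead of `3.2·10^6`,
corank `9` from `416,147`, corank `10` from `6.4·10^6`, …). Axioms: standard.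
-/

open scoped Matroid

namespace PercRepro

namespace ThmN

open Set

variable {α : Type}

/-- **THE BOUNDED-CORANK CORE FROM ITS POLYNOMIAL INEQUALITY** (the reusable kernel of `c025_core_explicit_bounded`):
at level `q ≥ 3`, corank `q + 1 ≤ d ≤ q + 2^q`, with the tail room `p + d ≥ 3(q + 2^q) + 5` and `2q ≤ p`, the `e`-free
core satisfies `RLS M p q` as soon as the `(P_d)` inequality `8·(C(p+d, q) + N) ≤ 7·2^{d−q}·C(p+q, q)` holds for
every `N ≤ σ(d)·(q−1)·2^{d+q}·C(p+d, q−2)`, `σ(d) = Σ_{j ≤ d−q−1} C(2^q − q − 2, j)` the exact fibre. Any sharper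
threshold is then a Mathlib-only arithmetic lemma plus this glue. -/
theorem c025_core_of_poly (q : ℕ) (hq : 3 ≤ q) (M : Matroid α) [M.Finite] (p d : ℕ)
    (hd1 : q + 1 ≤ d) (hd2 : d ≤ q + 2 ^ q) (htail : 3 * (q + 2 ^ q) + 5 ≤ p + d) (hhalf : 2 * q ≤ p)
    (hR : M.eRank = (p : ℕ∞)) (hn : M.E.ncard = p + d)
    (hfree : ∀ e ∈ M.E, ∃ A ⊆ M.E \ {e}, e ∉ M.closure A ∧ e ∉ M.closure ((M.E \ {e}) \ A))
    (hpoly : ∀ N : ℕ, N ≤ (∑ j ∈ Finset.range (d - (q + 1) + 1), Nat.choose (2 ^ q - 1 - (q + 1)) j) *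
        (q - 1) * 2 ^ (d + q) * (p + d).choose (q - 2) →
      8 * ((p + d).choose q + N) ≤ 7 * 2 ^ (d - q) * (p + q).choose q) :
    RLS M p q := by
  classical
  have hq1 := Explicit.succ_le_two_pow q
  have hEcard : M.ground_finite.toFinset.card = p + d := by
    rw [← Set.ncard_eq_toFinset_card _ M.ground_finite]; exact hn
  have hL : ∀ e ∈ M.E, ¬ M.IsLoop e := not_isLoop_of_free M hfree
  have hs : ∀ e ∈ M.E, ∀ f ∈ M.E, e ≠ f → M.eRk {e, f} = 2 := by
    intro e he f hf hef
    have h2 : (2 : ℕ∞) ≤ M.eRk {e, f} :=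
      two_le_eRk_of_two_le_ncard_of_free M hfree (pair_subset he hf) (by rw [ncard_pair hef])
    have h3 : M.eRk {e, f} ≤ 2 := by
      have := M.eRk_le_encard {e, f}
      rwa [encard_pair hef] at this
    exact le_antisymm h3 h2
  have hcirc : ∀ C, M.IsCircuit C → 3 ≤ C.encard := three_le_encard_of_circuit M hL hs
  have hflat : ∀ X ⊆ M.E, M.eRk X ≤ q → X.ncard ≤ 2 ^ q - 1 := by
    intro X hX hr
    have := ncard_add_one_le_two_pow_of_eRk_le M hL hfree q X hX hr
    omega
  have hd : M.E.encard = M.eRank + ((d : ℕ) : ℕ∞) := by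
    rw [hR, ← M.ground_finite.cast_ncard_eq, hn]
    push_cast
    ring
  have hU1 := Matroid.topCount_le_ncard_compl (M := M) hR hd q
  have hU2 := Matroid.ncard_eRk_eq_ncard_le_le M q (2 ^ q - 1) hcirc hflat d
  rw [hn] at hU2
  have hhalf' : q - 2 ≤ (p + d) / 2 := by omega
  have hsum : ∑ k ∈ Finset.Icc 3 (q + 1),
      {C | M.IsCircuit C ∧ C.ncard = k}.ncard * (p + d).choose (q + 1 - k) ≤
        (q - 1) * (2 ^ (d + q) * (p + d).choose (q - 2)) := by
    calc ∑ k ∈ Finset.Icc 3 (q + 1),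
          {C | M.IsCircuit C ∧ C.ncard = k}.ncard * (p + d).choose (q + 1 - k)
        ≤ ∑ _k ∈ Finset.Icc 3 (q + 1), 2 ^ (d + q) * (p + d).choose (q - 2) := by
          apply Finset.sum_le_sum
          intro k hk
          rw [Finset.mem_Icc] at hk
          have hc : {C | M.IsCircuit C ∧ C.ncard = k}.ncard ≤ (d + (k - 1)).choose k := by
            have := Matroid.ncard_circuits_le_choose_of_encard M hd (k - 1)
            rw [show k - 1 + 1 = k by omega] at this
            exact this
          have hc2 : (d + (k - 1)).choose k ≤ 2 ^ (d + q) :=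
            (Nat.choose_le_two_pow _ _).trans (Nat.pow_le_pow_right (by norm_num) (by omega))
          have hmono : (p + d).choose (q + 1 - k) ≤ (p + d).choose (q - 2) :=
            Explicit.choose_le_choose_of_le_half _ _ _ (by omega) hhalf'
          exact Nat.mul_le_mul (hc.trans hc2) hmono
      _ = (q - 1) * (2 ^ (d + q) * (p + d).choose (q - 2)) := by
          rw [Finset.sum_const, Nat.card_Icc, smul_eq_mul]
          congr 1
  set σ : ℕ := ∑ j ∈ Finset.range (d - (q + 1) + 1), Nat.choose (2 ^ q - 1 - (q + 1)) j with hσdef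
  set N : ℕ := σ * ∑ k ∈ Finset.Icc 3 (q + 1),
      {C | M.IsCircuit C ∧ C.ncard = k}.ncard * (p + d).choose (q + 1 - k) with hNdef
  have hN : N ≤ σ * (q - 1) * 2 ^ (d + q) * (p + d).choose (q - 2) := by
    calc N ≤ σ * ((q - 1) * (2 ^ (d + q) * (p + d).choose (q - 2))) := Nat.mul_le_mul_left _ hsum
      _ = _ := by ring
  have hU : Matroid.topCount M p q ≤ (p + d).choose q + N := hU1.trans hU2
  have hY := Matroid.two_pow_le_midCount_add (M := M) p q hR
  have hA : {X : Set α | X ⊆ M.E ∧ M.eRk X ≤ q}.ncard ≤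
      ∑ j ∈ Finset.range (2 ^ q - 1 + 1), (p + d).choose j := by
    calc {X : Set α | X ⊆ M.E ∧ M.eRk X ≤ q}.ncard
        ≤ {X : Set α | X ⊆ (M.ground_finite.toFinset : Set α) ∧ X.ncard ≤ 2 ^ q - 1}.ncard := by
          apply ncard_le_ncard
          · intro X hX
            exact ⟨by rw [Set.Finite.coe_toFinset]; exact hX.1, hflat X hX.1 hX.2⟩
          · exact (Finset.finite_toSet _).finite_subsets.subset (fun X hX => hX.1)
      _ ≤ ∑ j ∈ Finset.range (2 ^ q - 1 + 1), M.ground_finite.toFinset.card.choose j :=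
          ncard_subsets_ncard_le _ (2 ^ q - 1)
      _ = ∑ j ∈ Finset.range (2 ^ q - 1 + 1), (p + d).choose j := by rw [hEcard]
  have hB := Matroid.ncard_spanning_le (M := M) hd
  rw [hEcard] at hY hB
  have hT : 16 * ∑ j ∈ Finset.range (q + 2 ^ q + 1), (p + d).choose j ≤ 2 ^ (p + d) :=
    Explicit.sixteen_mul_sum_range_choose_le (q + 2 ^ q) (p + d) (by omega)
  have hA' : ∑ j ∈ Finset.range (2 ^ q - 1 + 1), (p + d).choose j ≤
      ∑ j ∈ Finset.range (q + 2 ^ q + 1), (p + d).choose j :=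
    Finset.sum_le_sum_of_subset_of_nonneg (Finset.range_mono (by omega)) (fun _ _ _ => Nat.zero_le _)
  have hB' : ∑ j ∈ Finset.range (d + 1), (p + d).choose j ≤
      ∑ j ∈ Finset.range (q + 2 ^ q + 1), (p + d).choose j :=
    Finset.sum_le_sum_of_subset_of_nonneg (Finset.range_mono (by omega)) (fun _ _ _ => Nat.zero_le _)
  have hAB : 8 * ({X : Set α | X ⊆ M.E ∧ M.eRk X ≤ q}.ncard +
      {X : Set α | X ⊆ M.E ∧ M.eRk X = M.eRank}.ncard) ≤ 2 ^ (p + d) := by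
    have h1 := hA.trans hA'
    have h2 := hB.trans hB'
    omega
  have hΦ := phiK_le_two_pow_div p q
  rw [Nat.choose_symm_add] at hΦ
  have hp' := hpoly N hN
  rw [RLS_iff]
  have hUq : (Matroid.topCount M p q : ℚ) ≤ ((p + d).choose q : ℚ) + (N : ℚ) := by exact_mod_cast hU
  have hYq : (2 : ℚ) ^ (p + d) ≤ (Matroid.midCount M p q : ℚ) +
      ({X : Set α | X ⊆ M.E ∧ M.eRk X ≤ q}.ncard : ℚ) +
      ({X : Set α | X ⊆ M.E ∧ M.eRk X = M.eRank}.ncard : ℚ) := by exact_mod_cast hY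
  have hABq : 8 * (({X : Set α | X ⊆ M.E ∧ M.eRk X ≤ q}.ncard : ℚ) +
      ({X : Set α | X ⊆ M.E ∧ M.eRk X = M.eRank}.ncard : ℚ)) ≤ 2 ^ (p + d) := by exact_mod_cast hAB
  have hpolyq : 8 * (((p + d).choose q : ℚ) + (N : ℚ)) ≤ 7 * 2 ^ (d - q) * ((p + q).choose q : ℚ) := by
    exact_mod_cast hp'
  have hU0 : (0 : ℚ) ≤ (Matroid.topCount M p q : ℚ) := Nat.cast_nonneg _
  exact level_arith (p := p) (d := d) (n := p + d) (q := q) rfl (by omega) hΦ hU0 hUq hYq hABq hpolyq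

namespace Explicit

/-- **(A5-iv, sharp)** `8N ≤ 5·2^m·C` from `N ≤ σ₀(q'+1)2^{2(q'+2)+1+m}·Cm`, `(p+1)²·Cm ≤ (q'+2)(q'+1)·Cn`, `Cn ≤ 2C` and the
EXACT requirement `16·σ₀·(q'+2)(q'+1)²·2^{2(q'+2)+1} ≤ 5·(p+1)²`. -/
theorem N_term_bound_sharp (q' m p N σ₀ Cm Cn C : ℕ)
    (hN : N ≤ σ₀ * (q' + 1) * 2 ^ (2 * (q' + 2) + 1 + m) * Cm)
    (h5 : (p + 1) ^ 2 * Cm ≤ (q' + 2) * (q' + 1) * Cn) (h3 : Cn ≤ 2 * C)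
    (hsq : 16 * σ₀ * ((q' + 2) * (q' + 1) ^ 2) * 2 ^ (2 * (q' + 2) + 1) ≤ 5 * (p + 1) ^ 2) :
    8 * N ≤ 5 * 2 ^ m * C := by
  have hp2 : 0 < (p + 1) ^ 2 := by positivity
  apply Nat.le_of_mul_le_mul_right _ hp2
  have hsplit : 2 ^ (2 * (q' + 2) + 1 + m) = 2 ^ (2 * (q' + 2) + 1) * 2 ^ m := pow_add _ _ _
  calc 8 * N * (p + 1) ^ 2
      ≤ 8 * (σ₀ * (q' + 1) * 2 ^ (2 * (q' + 2) + 1 + m) * Cm) * (p + 1) ^ 2 :=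
        Nat.mul_le_mul_right _ (Nat.mul_le_mul_left _ hN)
    _ = 8 * σ₀ * (q' + 1) * 2 ^ (2 * (q' + 2) + 1 + m) * ((p + 1) ^ 2 * Cm) := by ring
    _ ≤ 8 * σ₀ * (q' + 1) * 2 ^ (2 * (q' + 2) + 1 + m) * ((q' + 2) * (q' + 1) * Cn) :=
        Nat.mul_le_mul_left _ h5
    _ ≤ 8 * σ₀ * (q' + 1) * 2 ^ (2 * (q' + 2) + 1 + m) * ((q' + 2) * (q' + 1) * (2 * C)) :=
        Nat.mul_le_mul_left _ (Nat.mul_le_mul_left _ h3)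
    _ = (16 * σ₀ * ((q' + 2) * (q' + 1) ^ 2) * 2 ^ (2 * (q' + 2) + 1)) * (2 ^ m * C) := by
        rw [hsplit]; ring
    _ ≤ (5 * (p + 1) ^ 2) * (2 ^ m * C) := Nat.mul_le_mul_right _ hsq
    _ = 5 * 2 ^ m * C * (p + 1) ^ 2 := by ring

/-- The SHARP per-corank threshold `TcellS q m = q²·2^{⌊(qm+2q+4)/2⌋+1} + 16q·2^q + 3·2^q + 2q + 5`
(`TcellS 7 0 = 64,915`, `TcellS 8 0 = 164,629`). -/
def TcellS (q m : ℕ) : ℕ :=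
  q ^ 2 * 2 ^ ((q * m + 2 * q + 4) / 2 + 1) + 16 * q * 2 ^ q + 3 * 2 ^ q + 2 * q + 5

/-- **(A5-cell, sharp)** the `(P_d)` at ONE corank `d = q + 1 + m` for `p ≥ TcellS q m`, fibre `σ ≤ 2^{qm}`. -/
theorem poly_main_cell_sharp (q m p N σ : ℕ) (hq : 3 ≤ q) (hp : TcellS q m ≤ p) (hσ : σ ≤ 2 ^ (q * m))
    (hN : N ≤ σ * (q - 1) * 2 ^ (2 * q + 1 + m) * (p + q + 1 + m).choose (q - 2)) :
    8 * ((p + q + 1 + m).choose q + N) ≤ 7 * 2 ^ (m + 1) * (p + q).choose q := by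
  obtain ⟨q', rfl⟩ : ∃ q', q = q' + 2 := ⟨q - 2, by omega⟩
  have e1 : q' + 2 - 1 = q' + 1 := by omega
  have e2 : q' + 2 - 2 = q' := by omega
  rw [e1, e2] at hN
  unfold TcellS at hp
  set x := (q' + 2) * m + 2 * (q' + 2) + 4 with hx
  have hfirst : (q' + 2) ^ 2 * 2 ^ (x / 2 + 1) ≤ p + 1 := by omega
  have h16m : 8 * (2 * (q' + 2) * (m + 1)) ≤ p + 1 := by
    have hm : m + 1 ≤ 2 ^ m := succ_le_two_pow m
    have hexp : m + 4 ≤ x / 2 + 1 := by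
      have : 2 * m + 6 ≤ x := by rw [hx]; nlinarith
      omega
    calc 8 * (2 * (q' + 2) * (m + 1)) = 16 * (q' + 2) * (m + 1) := by ring
      _ ≤ 16 * (q' + 2) * 2 ^ m := Nat.mul_le_mul_left _ hm
      _ = (q' + 2) * 2 ^ (m + 4) := by ring
      _ ≤ (q' + 2) ^ 2 * 2 ^ (x / 2 + 1) :=
          Nat.mul_le_mul (by nlinarith) (Nat.pow_le_pow_right (by norm_num) hexp)
      _ ≤ p + 1 := hfirst
  obtain ⟨h2, h3⟩ := ratio_bounds (q' + 2) m p h16m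
  have h5 := choose_two_down (p + (q' + 2) + 1 + m) q' p (by omega)
  have hsq : 16 * σ * ((q' + 2) * (q' + 1) ^ 2) * 2 ^ (2 * (q' + 2) + 1) ≤ 5 * (p + 1) ^ 2 := by
    have hT2 := Nat.pow_le_pow_left hfirst 2
    have hsq' := sq_two_pow_half (q' + 2) x
    have hq3 : (q' + 2) * (q' + 1) ^ 2 ≤ (q' + 2) ^ 3 := by
      have : (q' + 1) ^ 2 ≤ (q' + 2) ^ 2 := Nat.pow_le_pow_left (by omega) 2
      calc (q' + 2) * (q' + 1) ^ 2 ≤ (q' + 2) * (q' + 2) ^ 2 := Nat.mul_le_mul_left _ this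
        _ = (q' + 2) ^ 3 := by ring
    calc 16 * σ * ((q' + 2) * (q' + 1) ^ 2) * 2 ^ (2 * (q' + 2) + 1)
        ≤ 16 * 2 ^ ((q' + 2) * m) * (q' + 2) ^ 3 * 2 ^ (2 * (q' + 2) + 1) := by gcongr
      _ = (q' + 2) ^ 3 * 2 ^ ((q' + 2) * m + 2 * (q' + 2) + 1 + 4) := by
          rw [show (16 : ℕ) = 2 ^ 4 by norm_num]; ring
      _ ≤ (q' + 2) ^ 4 * 2 ^ (x + 1) := by
          apply Nat.mul_le_mul
          · exact Nat.pow_le_pow_right (by omega) (by norm_num)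
          · exact Nat.pow_le_pow_right (by norm_num) (by omega)
      _ ≤ ((q' + 2) ^ 2 * 2 ^ (x / 2 + 1)) ^ 2 := hsq'
      _ ≤ (p + 1) ^ 2 := hT2
      _ ≤ 5 * (p + 1) ^ 2 := Nat.le_mul_of_pos_left _ (by norm_num)
  have h6 := N_term_bound_sharp q' m p N σ _ _ _ hN h5 h3 hsq
  have h7 : 9 + 5 * 2 ^ m ≤ 7 * 2 ^ (m + 1) := by
    have : 1 ≤ 2 ^ m := Nat.one_le_two_pow
    rw [pow_succ]; omega
  calc 8 * ((p + (q' + 2) + 1 + m).choose (q' + 2) + N)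
      = 8 * (p + (q' + 2) + 1 + m).choose (q' + 2) + 8 * N := by ring
    _ ≤ 9 * (p + (q' + 2)).choose (q' + 2) + 5 * 2 ^ m * (p + (q' + 2)).choose (q' + 2) :=
        Nat.add_le_add h2 h6
    _ = (9 + 5 * 2 ^ m) * (p + (q' + 2)).choose (q' + 2) := by ring
    _ ≤ 7 * 2 ^ (m + 1) * (p + (q' + 2)).choose (q' + 2) := Nat.mul_le_mul_right _ h7

end Explicit

/-- **THE SHARP CELL MAP**: the `e`-free core at level `q ≥ 3`, corank `d = q + 1 + m ≤ q + 2^q`, rank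
`p ≥ TcellS q m` (`TcellS 7 0 = 64,915`: at level `7` corank `8` closes from `p = 64,915`). -/
theorem c025_core_explicit_cell_sharp (q : ℕ) (hq : 3 ≤ q) (M : Matroid α) [M.Finite] (p d : ℕ)
    (hp : Explicit.TcellS q (d - (q + 1)) ≤ p) (hd1 : q + 1 ≤ d) (hd2 : d ≤ q + 2 ^ q)
    (hR : M.eRank = (p : ℕ∞)) (hn : M.E.ncard = p + d)
    (hfree : ∀ e ∈ M.E, ∃ A ⊆ M.E \ {e}, e ∉ M.closure A ∧ e ∉ M.closure ((M.E \ {e}) \ A)) :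
    RLS M p q := by
  obtain ⟨m, rfl⟩ : ∃ m, d = q + 1 + m := ⟨d - (q + 1), by omega⟩
  rw [show q + 1 + m - (q + 1) = m by omega] at hp
  have hq1 := Explicit.succ_le_two_pow q
  have hp16 : 16 * q * 2 ^ q + 3 * 2 ^ q + 2 * q + 5 ≤ p := by
    unfold Explicit.TcellS at hp; omega
  refine c025_core_of_poly q hq M p (q + 1 + m) (by omega) hd2 (by omega) (by nlinarith) hR hn hfree ?_
  intro N hN
  have hσ : ∑ j ∈ Finset.range (q + 1 + m - (q + 1) + 1), Nat.choose (2 ^ q - 1 - (q + 1)) j ≤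
      2 ^ (q * m) := by
    rw [show q + 1 + m - (q + 1) = m by omega]
    calc ∑ j ∈ Finset.range (m + 1), Nat.choose (2 ^ q - 1 - (q + 1)) j
        ≤ (2 ^ q - 1 - (q + 1) + 1) ^ m := Explicit.sum_range_choose_le_succ_pow _ m
      _ ≤ (2 ^ q) ^ m := Nat.pow_le_pow_left (by omega) m
      _ = 2 ^ (q * m) := by rw [← pow_mul]
  have hN' : N ≤ (∑ j ∈ Finset.range (q + 1 + m - (q + 1) + 1), Nat.choose (2 ^ q - 1 - (q + 1)) j) *
      (q - 1) * 2 ^ (2 * q + 1 + m) * (p + q + 1 + m).choose (q - 2) := by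
    rw [show 2 * q + 1 + m = q + 1 + m + q by ring, show p + q + 1 + m = p + (q + 1 + m) by ring]
    exact hN
  have := Explicit.poly_main_cell_sharp q m p N _ hq hp hσ hN'
  rw [show p + q + 1 + m = p + (q + 1 + m) by ring, show m + 1 = q + 1 + m - q by omega] at this
  exact this

end ThmN

end PercRepro
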